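import Summits.ResolutionOfSingularities.ResolutionOfSingularities.Theorems.WeightedInvariantLocalWeightedDropTrackCChartHom
import Literature.AlgebraicGeometry.Resolution.AlterationsNodeLocalStructure

/-!
# Track C, the blow-up step AT the centre (iii): the Cohen frame at the new point and the formal square

[OURS · L1 W4.3 · chain w43, stub worker 4] Helper for TRACK C of the engine crux `LocalWeightedDrop`
(stmt-ResolutionOfSingularities-8899; skeleton `L/res-L1-w43-stub-4/TrackC_Skeleton.lean`, lemma L2, in-centre case).
NOT a statement of any manuscript.

`exists_frame_square`: at the point `x' ∈ Z''` of the blow-up `τ : Z'' ⟶ Z'` whose local ring is the localization of the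
Rees chart `B = 𝒪_{Z',τ x'}[C/xᵢ]` at the prime `𝔴 = χ⁻¹(𝔪)` (`exists_point_of_chart`, `exists_chartHom`), the local ring is
regular of dimension `3` with residue field `k` and regular system of parameters `(xᵢ/cᵢ, cᵢ·u'_l/xᵢ, x_m)` (tree:
`isRsopPart_chartFamily_reesChart`, `IsBlowup.ringKrullDim_stalk_le_of_isLocallyNoetherian`); its Cohen frame `F''`
adapted to these parameters in the order of the game's slice variables (`stub_formalChart_cohen`) satisfies THE FORMAL
SQUARE `F''(τ̂♯ a) = ρ^*(F a)` (`ringEquiv_map_eq_subst`) — the completed blow-up at the Refuter's point IS the restricted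
chart substitution of `SliceChart.subst_restrictedChart`. Index bookkeeping on `Fin 3` is done by `decide`.
-/

noncomputable section

open CategoryTheory CategoryTheory.Limits AlgebraicGeometry TopologicalSpace IsLocalRing
open Literature.AlgebraicGeometry.Resolution
open Literature.RingTheory.MvPowerSeries.Jets
open Scheme.IdealSheafData

set_option linter.dupNamespace false -- mandated namespace of this single-conjunct summit

namespace Summit.ResolutionOfSingularities.ResolutionOfSingularities.Theorems.TrackC

/-! ## Index bookkeeping on `Fin 3`: the slice variable of a coordinate -/

/-- The inverse of `l ↦ predAbove i' l.succ` (`l ≠ i'`) recovers `l`. [OURS · folklore] -/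
theorem linv_predAbove (i' l : Fin 3) (h : l ≠ i') :
    (if ((Fin.predAbove i' l.succ : Fin 3) : ℕ) ≤ (i' : ℕ) then
      (⟨((Fin.predAbove i' l.succ : Fin 3) : ℕ) - 1, by omega⟩ : Fin 3) else Fin.predAbove i' l.succ) = l := by
  revert i' l; decide

/-- The slice variable of a coordinate `l ≠ i'` is not the exceptional variable `0`. [OURS · folklore] -/
theorem predAbove_succ_ne_zero (i' l : Fin 3) (h : l ≠ i') : Fin.predAbove i' l.succ ≠ 0 := by
  revert i' l; decide

/-- The coordinate of a slice variable `j ≠ 0` is not `i'`. [OURS · folklore] -/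
theorem linv_ne (i' j : Fin 3) (h : j ≠ 0) :
    (if (j : ℕ) ≤ (i' : ℕ) then (⟨(j : ℕ) - 1, by omega⟩ : Fin 3) else j) ≠ i' := by
  revert i' j; decide

/-- The slice variable of the coordinate of `j ≠ 0` is `j`. [OURS · folklore] -/
theorem predAbove_linv (i' j : Fin 3) (h : j ≠ 0) :
    Fin.predAbove i' (if (j : ℕ) ≤ (i' : ℕ) then (⟨(j : ℕ) - 1, by omega⟩ : Fin 3) else j).succ = j := by
  revert i' j; decide

variable {k : Type} [Field k]

/-! ## The frame at the new point -/

set_option maxHeartbeats 1600000 in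
-- one long bookkeeping proof (index combinatorics, span comparison, residue field, square)
/-- **The Cohen frame at the Refuter's point and the formal square.** See the module docstring. [OURS · folklore] -/
theorem exists_frame_square {Z' Z'' : Scheme.{0}} (σ : Z' ⟶ Spec (.of (MvPowerSeries (Fin 3) k)))
    (C : Z'.IdealSheafData) (τ : Z'' ⟶ Z') (hτ : IsBlowup τ C) [IsLocallyNoetherian Z'] (x' : Z'')
    [hN : IsNoetherianRing (Z'.presheaf.stalk (τ x'))] (F : Frame σ (τ x'))
    (x : Fin 3 → Z'.presheaf.stalk (τ x')) (hx : ∀ l, F.e (algebraMap _ _ (x l)) = MvPowerSeries.X l)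
    {n m : ℕ} (hnm : n + m = 3) (cv : Fin 3 → k) (iN : Fin n)
    (hci : cv (Fin.castLE (by omega) iN) ≠ 0) (hcv : ∀ l : Fin 3, n ≤ (l : ℕ) → cv l = 0)
    (u' : Fin n → Z'.presheaf.stalk (τ x')) (hu'i : u' iN = x (Fin.castLE (by omega) iN))
    (hu'l : ∀ l, l ≠ iN → u' l = x (Fin.castLE (by omega) l) -
      stalkConst σ (τ x') (cv (Fin.castLE (by omega) l) / cv (Fin.castLE (by omega) iN)) *
        x (Fin.castLE (by omega) iN))
    (wv : Fin m → Z'.presheaf.stalk (τ x')) (hwv : ∀ j : Fin m, wv j = x ⟨n + j, by omega⟩)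
    (hz : Ideal.span (Set.range (Fin.append u' wv)) = maximalIdeal (Z'.presheaf.stalk (τ x')))
    (χ : chartRing u' iN →+* MvPowerSeries (Fin 3) k)
    (hχb : ∀ r, χ (chartBase u' iN r) = MvPowerSeries.subst (fun l : Fin 3 =>
        (MvPowerSeries.X 0 : MvPowerSeries (Fin 3) k) ^ (if (l : ℕ) < n then 1 else 0) *
          (MvPowerSeries.C (cv l) + if l = Fin.castLE (by omega) iN then (0 : MvPowerSeries (Fin 3) k)
            else MvPowerSeries.X (Fin.predAbove (Fin.castLE (by omega) iN) l.succ))) (F.e (algebraMap _ _ r)))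
    (hχe : ∀ l, l ≠ iN → χ (chartGen u' iN l) =
        MvPowerSeries.C (cv (Fin.castLE (by omega) iN))⁻¹ *
          MvPowerSeries.X (Fin.predAbove (Fin.castLE (by omega) iN) (Fin.castLE (by omega) l).succ))
    (w : Spec (.of (chartRing u' iN))) (hw : w.asIdeal = Ideal.comap χ (maximalIdeal _))
    (q : Spec (.of (chartRing u' iN)) ⟶ Z'') (hq : q w = x') (hiso : IsIso (q.stalkMap w))
    (hsq : q ≫ τ = Spec.map (CommRingCat.ofHom (chartBase u' iN)) ≫ Z'.fromSpecStalk (τ x')) :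
    ∃ (hN'' : IsNoetherianRing (Z''.presheaf.stalk x')) (F'' : @Frame k _ Z'' (τ ≫ σ) x' hN''),
      ∀ a, F''.e (DeJong1996.completedStalkMap τ x' a) = MvPowerSeries.subst (fun l : Fin 3 =>
        (MvPowerSeries.X 0 : MvPowerSeries (Fin 3) k) ^ (if (l : ℕ) < n then 1 else 0) *
          (MvPowerSeries.C (cv l) + if l = Fin.castLE (by omega) iN then (0 : MvPowerSeries (Fin 3) k)
            else MvPowerSeries.X (Fin.predAbove (Fin.castLE (by omega) iN) l.succ))) (F.e a) := by
  classical
  haveI := F.isRegularLocalRing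
  haveI : IsDomain (MvPowerSeries (Fin 3) k) := NoZeroDivisors.to_isDomain _
  have hn3 : n ≤ 3 := by omega
  set i' : Fin 3 := Fin.castLE hn3 iN with hi'
  have hi'lt : ((i' : Fin 3) : ℕ) < n := by simp [hi']
  set κ : k →+* Z'.presheaf.stalk (τ x') := stalkConst σ (τ x') with hκ
  set κ'' : k →+* Z''.presheaf.stalk x' := stalkConst (τ ≫ σ) x' with hκ''
  set ρ : Fin 3 → MvPowerSeries (Fin 3) k := fun l : Fin 3 =>
    (MvPowerSeries.X 0 : MvPowerSeries (Fin 3) k) ^ (if (l : ℕ) < n then 1 else 0) *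
      (MvPowerSeries.C (cv l) + if l = i' then (0 : MvPowerSeries (Fin 3) k)
        else MvPowerSeries.X (Fin.predAbove i' l.succ)) with hρ
  have hρ0 : ∀ l, MvPowerSeries.constantCoeff (ρ l) = 0 := constantCoeff_rchart cv i' n hcv
  have hρs : MvPowerSeries.HasSubst ρ := MvPowerSeries.hasSubst_of_constantCoeff_zero hρ0
  -- S1: the local ring of `x'` is the localization of the chart ring at `𝔴`
  haveI := hiso
  obtain ⟨χ'', hχ''b, hloc, hw𝔪⟩ :=
    exists_stalk_ringHom_of_chart τ x' (CommRingCat.ofHom (chartBase u' iN)) q w hq hsq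
  replace hχ''b : ∀ a, χ'' (chartBase u' iN a) = (τ.stalkMap x').hom a := fun a => hχ''b a
  replace hw𝔪 : Ideal.comap (chartBase u' iN) w.asIdeal = maximalIdeal _ := hw𝔪
  letI algB : Algebra (chartRing u' iN) (Z''.presheaf.stalk x') := χ''.toAlgebra
  haveI : IsLocalization.AtPrime (Z''.presheaf.stalk x') w.asIdeal := hloc
  have halg : ∀ b, algebraMap (chartRing u' iN) (Z''.presheaf.stalk x') b = χ'' b := fun b =>
    congrFun (congrArg DFunLike.coe (RingHom.algebraMap_toAlgebra χ'')) b
  -- S2: Noetherian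
  haveI hBN : IsNoetherianRing (chartRing u' iN) := isNoetherianRing_blowupChart u' iN
  have hN'' : IsNoetherianRing (Z''.presheaf.stalk x') := IsLocalization.isNoetherianRing w.asIdeal.primeCompl (Z''.presheaf.stalk x') hBN
  haveI := hN''
  -- constants: `κ'' = τ♯ ∘ κ = χ'' ∘ φ ∘ κ`
  have hκ''eq : ∀ a, κ'' a = χ'' (chartBase u' iN (κ a)) := by
    intro a
    rw [hχ''b]
    change (Z''.presheaf.germ ⊤ x' trivial).hom ((τ ≫ σ).appTop.hom _) = _
    rw [Scheme.Hom.comp_appTop, CommRingCat.comp_apply]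
    exact Scheme.Hom.germ_stalkMap_apply τ ⊤ x' trivial _ |>.symm
  -- S4: the enumeration of the indices `l ≠ iN`
  obtain ⟨n', hn'⟩ : ∃ n', n = n' + 1 := ⟨n - 1, by have := iN.2; omega⟩
  subst hn'
  let jJ : Fin n' → {j : Fin (n' + 1) // j ≠ iN} := fun r => ⟨iN.succAbove r, Fin.succAbove_ne iN r⟩
  have hjJ : Function.Injective jJ := fun a b h => Fin.succAbove_right_injective (congrArg Subtype.val h)
  have hJ : ∀ r, chartGen u' iN (jJ r).1 ∈ w.asIdeal := by
    intro r
    rw [hw, Ideal.mem_comap, hχe _ (jJ r).2, mem_maximalIdeal_iff_constantCoeff_eq_zero]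
    simp
  -- S3: the dimension count at `τ x'`
  have hd : (maximalIdeal (Z'.presheaf.stalk (τ x'))).spanFinrank = (n' + 1) + m := by
    have h := IsRegularLocalRing.spanFinrank_maximalIdeal (R := (Z'.presheaf.stalk (τ x')))
    rw [F.ringKrullDim_eq] at h
    have h3 : (maximalIdeal (Z'.presheaf.stalk (τ x'))).spanFinrank = 3 := by exact_mod_cast h
    omega
  -- S5: the regular system of parameters of the chart (tree)
  have hrs := isRsopPart_chartFamily_reesChart u' iN wv hz hd w.asIdeal hw𝔪 (Z''.presheaf.stalk x') jJ hjJ hJ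
  haveI hreg'' : IsRegularLocalRing (Z''.presheaf.stalk x') := hrs.isRegularLocalRing
  obtain ⟨e', y', hdim'', hspanζ⟩ := hrs.2
  -- S6: dimension `3`, so `e' = 0`
  have hdimle : ringKrullDim (Z''.presheaf.stalk x') ≤ (3 : ℕ) := by
    have h := hτ.ringKrullDim_stalk_le_of_isLocallyNoetherian x'
    rw [F.ringKrullDim_eq] at h
    exact h
  have he' : e' = 0 := by
    rw [hdim''] at hdimle
    have : n' + m + 1 + e' ≤ 3 := by exact_mod_cast hdimle
    omega
  subst he'
  have hdim3 : ringKrullDim (Z''.presheaf.stalk x') = (3 : ℕ) := by rw [hdim'']; congr 1; omega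
  have hspanζ' : Ideal.span (Set.range (chartFamily u' iN wv (Z''.presheaf.stalk x') (chartBase u' iN) (chartGen u' iN) jJ)) =
      maximalIdeal (Z''.presheaf.stalk x') := by
    rw [← hspanζ, Set.range_eq_empty y', Set.union_empty]
  -- S7: the chart elements in `𝒪_{Z'',x'}` and the rescaled regular system of parameters in slice order
  obtain ⟨U, hU⟩ : ∃ U : Z''.presheaf.stalk x', U = χ'' (chartBase u' iN (u' iN)) := ⟨_, rfl⟩
  obtain ⟨E, hE⟩ : ∃ E : Fin (n' + 1) → Z''.presheaf.stalk x', E = fun l => χ'' (chartGen u' iN l) :=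
    ⟨_, rfl⟩
  obtain ⟨XV, hXV⟩ : ∃ XV : Fin 3 → Z''.presheaf.stalk x', XV = fun l => χ'' (chartBase u' iN (x l)) :=
    ⟨_, rfl⟩
  obtain ⟨cU, hcU⟩ : ∃ cU : Z''.presheaf.stalk x', cU = κ'' (cv i') := ⟨_, rfl⟩
  have hcUinv : cU * κ'' (cv i')⁻¹ = 1 := by rw [hcU, ← map_mul, mul_inv_cancel₀ hci, map_one]
  have hcUinv' : κ'' (cv i')⁻¹ * cU = 1 := by rw [mul_comm, hcUinv]
  -- `linv j` = the coordinate whose slice variable is `j`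
  obtain ⟨linv, hlinv⟩ : ∃ linv : Fin 3 → Fin 3, linv = fun j : Fin 3 =>
      if (j : ℕ) ≤ (i' : ℕ) then (⟨(j : ℕ) - 1, by omega⟩ : Fin 3) else j := ⟨_, rfl⟩
  have hlinvp : ∀ l : Fin 3, l ≠ i' → linv (Fin.predAbove i' l.succ) = l := fun l hl => by
    rw [hlinv]; exact linv_predAbove i' l hl
  have hplinv : ∀ j : Fin 3, j ≠ 0 → Fin.predAbove i' (linv j).succ = j := fun j hj => by
    rw [hlinv]; exact predAbove_linv i' j hj
  have hlinvne : ∀ j : Fin 3, j ≠ 0 → linv j ≠ i' := fun j hj => by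
    rw [hlinv]; exact linv_ne i' j hj
  obtain ⟨ζ', hζ'⟩ : ∃ ζ' : Fin 3 → Z''.presheaf.stalk x', ζ' = fun j : Fin 3 => if j = 0 then κ'' (cv i')⁻¹ * U else
    if h : ((linv j : Fin 3) : ℕ) < n' + 1 then cU * E ⟨(linv j : ℕ), h⟩ else XV (linv j) := ⟨_, rfl⟩
  have hζ'0 : ζ' 0 = κ'' (cv i')⁻¹ * U := by rw [hζ']; simp
  have hζ'pos : ∀ j : Fin 3, j ≠ 0 → ∀ hlt : ((linv j : Fin 3) : ℕ) < n' + 1,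
      ζ' j = cU * E ⟨(linv j : ℕ), hlt⟩ := by
    intro j hj hlt
    rw [hζ']
    simp only [hj, if_false, dif_pos hlt]
  have hζ'pos' : ∀ j : Fin 3, j ≠ 0 → n' + 1 ≤ ((linv j : Fin 3) : ℕ) → ζ' j = XV (linv j) := by
    intro j hj hge
    rw [hζ']
    simp only [hj, if_false, dif_neg (not_lt.mpr hge)]
  have hζ'lt : ∀ (lN : Fin (n' + 1)), lN ≠ iN →
      ζ' (Fin.predAbove i' (Fin.castLE hn3 lN).succ) = cU * E lN := by
    intro lN hlN
    have hne : Fin.castLE hn3 lN ≠ i' := fun h => hlN (Fin.castLE_injective hn3 (by rw [h, hi']))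
    have h1 : Fin.predAbove i' (Fin.castLE hn3 lN).succ ≠ 0 := predAbove_succ_ne_zero i' _ hne
    have h2 := hlinvp _ hne
    have h3 : ((linv (Fin.predAbove i' (Fin.castLE hn3 lN).succ) : Fin 3) : ℕ) < n' + 1 := by
      rw [h2, Fin.val_castLE]; exact lN.2
    rw [hζ'pos _ h1 h3]
    congr 2
    exact Fin.ext (by simp [h2])
  have hζ'ge : ∀ (l : Fin 3), n' + 1 ≤ (l : ℕ) → ζ' (Fin.predAbove i' l.succ) = XV l := by
    intro l hl
    have hne : l ≠ i' := fun h => by rw [h] at hl; exact absurd hi'lt (not_lt.mpr hl)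
    have h1 : Fin.predAbove i' l.succ ≠ 0 := predAbove_succ_ne_zero i' _ hne
    have h2 := hlinvp _ hne
    rw [hζ'pos' _ h1 (by rw [h2]; exact hl), h2]
  -- the chart family of the tree, read through `χ''`
  have hζ0 : chartFamily u' iN wv (Z''.presheaf.stalk x') (chartBase u' iN) (chartGen u' iN) jJ 0 = U := by
    simp [chartFamily, halg, hU]
  have hζE : ∀ r : Fin n', chartFamily u' iN wv (Z''.presheaf.stalk x') (chartBase u' iN) (chartGen u' iN) jJ
      (Fin.succ (Fin.castAdd m r)) = E (iN.succAbove r) := by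
    intro r
    simp [chartFamily, halg, hE, jJ]
  have hζW : ∀ j : Fin m, chartFamily u' iN wv (Z''.presheaf.stalk x') (chartBase u' iN) (chartGen u' iN) jJ
      (Fin.succ (Fin.natAdd n' j)) = XV ⟨n' + 1 + j, by omega⟩ := by
    intro j
    simp [chartFamily, halg, hXV, hwv]
  have hspan' : Ideal.span (Set.range ζ') = maximalIdeal (Z''.presheaf.stalk x') := by
    rw [← hspanζ']
    apply le_antisymm
    · rw [Ideal.span_le]
      rintro _ ⟨j, rfl⟩
      by_cases hj : j = 0
      · subst hj
        rw [hζ'0, SetLike.mem_coe]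
        refine Ideal.mul_mem_left _ _ (Ideal.subset_span ⟨0, hζ0⟩)
      · have hli := hlinvne j hj
        by_cases hlt : ((linv j : Fin 3) : ℕ) < n' + 1
        · -- a translated generator
          have hlNne : (⟨(linv j : ℕ), hlt⟩ : Fin (n' + 1)) ≠ iN := fun h => hli (by
            apply Fin.ext; have := congrArg Fin.val h; simpa [hi'] using this)
          obtain ⟨r, hr⟩ := Fin.exists_succAbove_eq hlNne
          have hval : ζ' j = cU * E ⟨(linv j : ℕ), hlt⟩ := hζ'pos j hj hlt
          rw [hval, SetLike.mem_coe]
          refine Ideal.mul_mem_left _ _ (Ideal.subset_span ⟨Fin.succ (Fin.castAdd m r), ?_⟩)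
          rw [hζE, hr]
        · -- a remaining coordinate
          have hge : n' + 1 ≤ ((linv j : Fin 3) : ℕ) := not_lt.mp hlt
          have hval : ζ' j = XV (linv j) := hζ'pos' j hj hge
          rw [hval, SetLike.mem_coe]
          have hj3 := (linv j).2
          refine Ideal.subset_span ⟨Fin.succ (Fin.natAdd n' ⟨(linv j : ℕ) - (n' + 1), by omega⟩), ?_⟩
          rw [hζW]
          congr 1
          exact Fin.ext (by simp; omega)
    · rw [Ideal.span_le]
      rintro _ ⟨r, rfl⟩
      rw [SetLike.mem_coe]
      refine Fin.cases ?_ (fun r' => ?_) r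
      · -- `U = c · ζ' 0`
        rw [hζ0, show U = cU * ζ' 0 by rw [hζ'0, ← mul_assoc, hcUinv, one_mul]]
        exact Ideal.mul_mem_left _ _ (Ideal.subset_span ⟨0, rfl⟩)
      · refine Fin.addCases (fun r'' => ?_) (fun j => ?_) r'
        · -- `E (succAbove r'') = c⁻¹ · ζ' (…)`
          rw [hζE]
          have h1 := hζ'lt (iN.succAbove r'') (Fin.succAbove_ne iN r'')
          rw [show E (iN.succAbove r'') = κ'' (cv i')⁻¹ * ζ' (Fin.predAbove i' (Fin.castLE hn3 (iN.succAbove r'')).succ)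
            by rw [h1, ← mul_assoc, hcUinv', one_mul]]
          exact Ideal.mul_mem_left _ _ (Ideal.subset_span ⟨_, rfl⟩)
        · rw [hζW, ← hζ'ge ⟨n' + 1 + j, by omega⟩ (by simp)]
          exact Ideal.subset_span ⟨_, rfl⟩
  -- S8: the residue field is `k`
  have hunit : ∀ t : w.asIdeal.primeCompl, IsUnit (χ t) := by
    rintro ⟨t, ht⟩
    change t ∉ w.asIdeal at ht
    rw [hw, Ideal.mem_comap] at ht
    by_contra hu
    exact ht ((IsLocalRing.mem_maximalIdeal _).mpr (mem_nonunits_iff.mpr hu))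
  let η : (Z''.presheaf.stalk x') →+* MvPowerSeries (Fin 3) k := IsLocalization.lift (M := w.asIdeal.primeCompl) hunit
  have hη : ∀ b, η (χ'' b) = χ b := fun b => IsLocalization.lift_eq (M := w.asIdeal.primeCompl) hunit b
  have hηκ : ∀ a, η (κ'' a) = MvPowerSeries.C a := by
    intro a
    rw [hκ''eq, hη, hχb, F.map_const]
    exact MvPowerSeries.subst_C (a := ρ) a
  have hmax'' : maximalIdeal (Z''.presheaf.stalk x') = w.asIdeal.map (algebraMap (chartRing u' iN) (Z''.presheaf.stalk x')) :=
    (IsLocalization.AtPrime.map_eq_maximalIdeal w.asIdeal (Z''.presheaf.stalk x')).symm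
  have hηloc : Ideal.comap η (maximalIdeal (MvPowerSeries (Fin 3) k)) = maximalIdeal (Z''.presheaf.stalk x') := by
    apply le_antisymm
    · exact IsLocalRing.le_maximalIdeal (Ideal.comap_ne_top _ (Ideal.IsMaximal.ne_top inferInstance))
    · rw [hmax'', Ideal.map_le_iff_le_comap]
      intro b hb
      rw [Ideal.mem_comap, Ideal.mem_comap, halg, hη]
      rw [hw, Ideal.mem_comap] at hb
      exact hb
  have hsurj : Function.Surjective ((residue (Z''.presheaf.stalk x')).comp κ'') := by
    intro q0
    obtain ⟨a, rfl⟩ := Ideal.Quotient.mk_surjective q0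
    refine ⟨MvPowerSeries.constantCoeff (η a), ?_⟩
    rw [RingHom.comp_apply]
    change residue (Z''.presheaf.stalk x') _ = residue (Z''.presheaf.stalk x') a
    rw [← sub_eq_zero, ← map_sub, residue_eq_zero_iff, ← hηloc, Ideal.mem_comap,
      mem_maximalIdeal_iff_constantCoeff_eq_zero, map_sub, hηκ, map_sub, MvPowerSeries.constantCoeff_C, sub_self]
  -- S9: the adapted frame and the square
  obtain ⟨e'', he''ζ, he''c, -⟩ := stub_formalChart_cohen (Z''.presheaf.stalk x') κ'' hsurj ζ' hspan' hdim3
  refine ⟨hN'', ⟨e'', he''c⟩, fun a => ?_⟩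
  have hof : ∀ b : (Z'.presheaf.stalk (τ x')), DeJong1996.completedStalkMap τ x' (algebraMap (Z'.presheaf.stalk (τ x')) _ b) =
      algebraMap (Z''.presheaf.stalk x') _ ((τ.stalkMap x').hom b) := fun b => DeJong1996.completedStalkMap_of τ x' b
  refine ringEquiv_map_eq_subst F.e e'' ρ hρ0 ((algebraMap (Z'.presheaf.stalk (τ x')) _).comp κ) (fun c => F.map_const c)
    (fun l => algebraMap (Z'.presheaf.stalk (τ x')) _ (x l)) hx F.approx (DeJong1996.completedStalkMap τ x')
    (map_maximalIdeal_completedStalkMap_le τ x') (fun c => ?_) (fun l => ?_) a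
  · -- constants
    rw [RingHom.comp_apply, hof, ← hχ''b, ← hκ''eq]
    exact he''c c
  · -- the coordinates: `e''(τ♯ x_l) = ρ_l`
    rw [hof, ← hχ''b, show χ'' (chartBase u' iN (x l)) = XV l by simp only [hXV]]
    by_cases hli : l = i'
    · -- the exceptional coordinate
      subst hli
      have h1 : XV i' = cU * ζ' 0 := by
        simp only [hXV]
        rw [← hu'i, ← hU, hζ'0, ← mul_assoc, hcUinv, one_mul]
      have hρi : ρ i' = MvPowerSeries.X 0 * MvPowerSeries.C (cv i') := by
        simp only [hρ, hi'lt, if_true, pow_one, add_zero]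
      rw [h1, map_mul, map_mul, he''ζ, hcU, he''c, hρi]
      ring
    · by_cases hlt : (l : ℕ) < n' + 1
      · -- a centre coordinate `l ≠ i'`
        obtain ⟨lN, hlN⟩ : ∃ lN : Fin (n' + 1), lN = ⟨(l : ℕ), hlt⟩ := ⟨_, rfl⟩
        have hl : Fin.castLE hn3 lN = l := Fin.ext (by simp [hlN])
        have hlNne : lN ≠ iN := fun h => hli (by rw [← hl, h, hi'])
        have hxl : x l = u' lN + κ (cv l / cv i') * u' iN := by
          rw [hu'l lN hlNne, hl, hu'i]; ring
        have hφ : chartBase u' iN (u' lN) = chartBase u' iN (u' iN) * chartGen u' iN lN :=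
          reesChartBase_apply_eq_mul_chartGen u' iN lN
        have hz1 := hζ'lt lN hlNne
        rw [hl] at hz1
        have eXV : XV l = U * E lN + κ'' (cv l / cv i') * U := by
          simp only [hXV, hU, hE]
          rw [hxl]
          simp only [map_add, map_mul, hφ, ← hκ''eq]
        have e1 : κ'' (cv l / cv i') = κ'' (cv l) * κ'' (cv i')⁻¹ := by rw [← map_mul, div_eq_mul_inv]
        have h1 : XV l = ζ' 0 * ζ' (Fin.predAbove i' l.succ) + κ'' (cv l) * ζ' 0 := by
          rw [hz1, hζ'0, eXV, e1]
          linear_combination (-(U * E lN)) * hcUinv'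
        have hρl : ρ l = MvPowerSeries.X 0 * (MvPowerSeries.C (cv l) + MvPowerSeries.X (Fin.predAbove i' l.succ)) := by
          simp only [hρ, hlt, hli, if_true, pow_one, if_false]
        rw [h1]
        simp only [map_add, map_mul, he''ζ, he''c]
        rw [hρl]
        ring
      · -- a remaining coordinate
        have hge : n' + 1 ≤ (l : ℕ) := not_lt.mp hlt
        rw [← hζ'ge l hge, he''ζ]
        simp only [hρ, hlt, hli, hcv l hge, if_false, pow_zero, one_mul, map_zero, zero_add]

end Summit.ResolutionOfSingularities.ResolutionOfSingularities.Theorems.TrackC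

end
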